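import Mathlib
import HarnessLib
import HarnessLib.Audit
import Summits.CriticalPhenomena.Statement
import Literature.Probability.RandomPlanarGeometry.YangBaxterSAWLaw
import Literature.Probability.RandomPlanarGeometry.ChordalCurveFamily
import Literature.Probability.RandomPlanarGeometry.ChordalRestrictionMarkov
import Literature.Probability.RandomPlanarGeometry.ChordalReversibility
import Literature.Probability.RandomPlanarGeometry.ConformalRestrictionHolds
import HarnessLib.Audit.Status.Attr

/-!
Route: SAWTrackTransport

DORMANT since 2026-08-24T07:10:32Z (reconciler: no traction for 6.6 d (last activity item-evidence-added at 2026-08-17T16:45:29Z); parked, not closed — `ledger route dormant route-CriticalPhenomena-SAWTrackTransport --off` to reactivate) — unstaffed, not closed; items shared with open routes are served there. `ledger route dormant <id> --off` reactivates.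

# Route SAWTrackTransport — turn the rhombi, not the walk — rotation invariance of the n = 0
Yang–Baxter walk by zero-drift track transport (DKKMO at n = 0), then rotation-rigidity and the
YB→ℤ² toll

It suffices to show X = (AU) ∧ (L) ∧ (Ax) ∧ (R*_rot) ∧ (U): (AU) AngleUniversality — a robust full
chordal scaling limit of the CRITICAL YANG–BAXTER WALK on Glazman–Manolescu's square tiling (angle
π/2; GlazmanManolescu2019 §1, the n = 0 Nienhuis point) is also the full limit of the critical
Yang–Baxter walk on the rhombic tiling of EVERY angle α ∈ [π/3, 2π/3] when curves are drawn in the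
isoradial embedding — the n = 0 analogue of Duminil-Copin–Kozlowski–Krachun–Manolescu–Oulamara's
universality theorem (DKKMO2020Rotational Thm 2.1), to be proved by their TRACK (column) TRANSPORT:
Glazman–Manolescu's Yang–Baxter column exchange used as a measure-preserving coupling of walks, plus
an n = 0 ZERO-DRIFT identity (the analogue of DKKMO Thm 2.4, P[apex jumps] = sin α/(sin α + sin β),
from commuting column transfer matrices and the sin θ-anisotropy of the n = 0 finite-size gaps); (L)
YBLimitExists — that walk has a robust full limit P; (Ax) AxiomsOfLimit — P is translation
covariant, similarity covariant once rotation covariant, restriction–Markov, reversible, conjugation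
covariant, simple; (R*_rot) RStarRot — rotation-invariant restriction–Markov rigidity (shared
verbatim with route SAWIsotropicAnchor, stmt-CriticalPhenomena-7298); (U) YBtoUniform — the critical
square-tiling Yang–Baxter law and the uniform critical δℤ² law `SAW.law` are asymptotically equal on
bounded continuous test functions. The sixth crux MirrorRotation is DKKMO's reflection trick (the
rhombic tiling of angle α is mirror-symmetric across the direction e^(iα/2), the square tiling
across the axes; AU makes the first mirror an asymptotic symmetry of P; two mirrors at angles α/2,
α'/2 compose to the rotation by α − α', an interval of angles, hence all rotations); the PROVED
Literature theorem LawlerSchrammWerner2003_holds (listed as the shared support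
LSW2003Characterisation, stmt-CriticalPhenomena-8230) turns conformal restriction into SLE_(8/3);
existence of endpoint approximations at every angle rides as the first conjunct of YBLimitExists. No
idea card is realised (novel-route seat); nearest tree objects: retired SAWHexUniversality r5
(Θ-independence as a HYPOTHESIS for hex→ℤ² transfer) and SAWCompassLattice (the same integrable
point, attacked by the parafermion).
Lean: `AngleUniversality ∧ YBLimitExists ∧ AxiomsOfLimit ∧ RStarRot ∧ YBtoUniform`

## Assembly
The deciding theorem `closes` (CRUX-ONLY hypotheses; proved sorry-free in the planner's Sketch.lean,
axioms propext / Classical.choice / Quot.sound) is pure logic plus `integral_map`: fix D and a δℤ²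
endpoint approximation (a, b); YBLimitExists gives endpoint approximations at every angle (π/2 ∈
[π/3, 2π/3] by `nlinarith [Real.pi_pos]`), hence (a′, b′) of D, and P chordal with RL(π/2) P;
AxiomsOfLimit gives translation covariance, (rotation ⇒ similarity), restriction–Markov,
reversibility, conjugation covariance, simplicity; MirrorRotation fed with AngleUniversality gives
rotation covariance, hence IsSimilarityCovariant; RStarRot gives IsConformallyCovariant; the proved
Literature theorem LawlerSchrammWerner2003_holds (with IsRestrictionMarkov.isRestriction) gives
IsSLELaw (8/3) D (P D), i.e. an SLE_(8/3) curve Γ with law P D; RL(π/2) specialised to u ≡ 0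
(carrier equality `(D.map (similarity 1 _ 0)).carrier = D.carrier` transported by `subst`) gives ∫
f∘curve d ybLaw(D)_δ → ∫ f dP D; YBtoUniform adds the o(1) comparison, so the δℤ² SAW curves
converge in law to Γ (`Tendsto.add`, `sub_add_cancel`); a.e.-measurability is
SAW.aemeasurable_curve. ArchTransport and LSW2003Characterisation are supports not consumed by
`closes`.

Rationale: WHY THIS LINE. DKKMO2020Rotational (arXiv:2012.11672, Thms 1.2, 2.1, 2.4, Prop. 2.5, Thm 2.7) is the
only mechanism that has ever produced a CONTINUOUS spatial symmetry (rotations) for planar models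
whose discrete holomorphicity is incomplete (FK percolation, 1 ≤ q ≤ 4, q ≠ 2): an exact
measure-preserving star–triangle TRACK TRANSPORT between isoradial embeddings, whose only non-soft
input is one exact identity — the drift of cluster extrema under the passage of a track of angle α
through tracks of angle β vanishes, P = sin α/(sin α + sin β) (their Thm 2.4) — harvested from
commuting transfer matrices on the torus and the sin θ-proportionality of finite-size gaps (Thm 2.7,
from the six-vertex Bethe ansatz, arXiv:2012.11675). The self-avoiding walk is exactly in this
situation (barrier ParafermionicHalfCauchyRiemann: half of Cauchy–Riemann only) AND has the exact
coupling: Glazman–Manolescu (GlazmanManolescu2019 = arXiv:1708.00395, §3, Thms 1–3;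
Glazman2015WeightedSAW; weights of Nienhuis1990 / IkhlefCardy2009) proved that the Yang–Baxter
column exchange preserves the law of the n = 0 walk and used it for SCALAR universality (critical
fugacity, boundary two-point function, bridge decay B_T → 0); route SAWBrickWallHomotopy records
that "the star–triangle coupling [is] absent for SAW" — true for the uniform ℤ² walk, false at the
Yang–Baxter point, which SAWCompassLattice even realises as an honest ℤ²-periodic D4-symmetric SAW.
Imported: integrable probability (Yang–Baxter / Z-invariance as a COUPLING, not as an observable),
DKKMO's marked-extrema bookkeeping (here for ONE curve: its own mesoscopic sub-arc extrema are the
nails, no ambient clusters needed), finite-size spectra of the n = 0 (Izergin–Korepin / dilute O(n))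
transfer matrix for the zero-drift identity (doi:10.1088/0305-4470/20/7/006 Kim–Pearce anisotropy
factor; doi:10.1103/physrevlett.62.2425 Batchelor–Nienhuis–Warnaar and
doi:10.1088/0305-4470/25/11/016 Warnaar–Batchelor–Nienhuis for the dilute O(n)/Izergin–Korepin Bethe
ansatz), Kesten-type ratio limits for the apex-pinned two-sided walk (Kesten1963SAW,
MadrasSlade1993). What it does that the 58 open routes do not: rotation invariance is DERIVED for a
lattice SAW by an exact coupling plus one checkable lattice identity (SAWGaussianRotation and
SAWIsotropicAnchor pay for rotation with unmechanised universality cruxes; SAWBrickWallHomotopy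
transports only modulo a linear modulus; SAWCompassLattice/SAWBetheAnsatz use integrability for an
observable or an exponent, never for symmetry), after which only the rotation-invariant rigidity
R*_rot (strictly weaker than the quarter-turn R* of SAWRestrictionRigidity) and the standard YB→ℤ²
toll remain.

RANKED CRUXES. #2 AngleUniversality (crux) — For every α ∈ [π/3, 2π/3] and every chordal family P:
if P is the ROBUST FULL LIMIT of the critical (x = 1) Glazman–Manolescu Yang–Baxter walk on the
square tiling (RL(π/2) P: for every Dobrushin domain D, every family of sub-mesh translates D + u_δ,
‖u_δ‖ ≤ δ, and every family of mid-edge endpoints joined in (D + u_δ)_δ whose rescaled midpoints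
tend to the marked points, the law `ybLaw (π/2) (D + u_δ) δ 1 a_δ b_δ` pushed to `CurveClass ℂ` by
`YBWalk.curve` converges in law to P D), then P is also the robust full limit RL(α) P of the
critical Yang–Baxter walk on the rhombic tiling of constant angle α, curves drawn in the isoradial
embedding `planeMidpoint (fun _ => α)`. Intended proof = DKKMO's scheme at n = 0: Glazman–Manolescu
column exchanges bring α-columns through π/2-columns as a coupling of walks; per exchange the curve
moves O(δ); the accumulated displacement of its mesoscopic sub-arc extrema is o(1) by the n = 0
ZERO-DRIFT identity (filed informal: apex of the pinned two-sided walk jumps to the far line with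
probability sin α/(sin α + sin β)); passage to bounded domains through the full-plane critical
polygon gas / exact restriction. [difficulty: open-problem] (why it might fail: zero drift at n = 0
needs sin θ-proportional gaps of the dilute-O(0) (Izergin–Korepin) column transfer matrix —
Bethe-ansatz level, unproved; without RSW, separation of competing extrema and the apex-pinned
infinite walk (Kesten ratio limits) may fail.) [DKKMO2020Rotational, GlazmanManolescu2019,
Glazman2015WeightedSAW, arXiv:2012.11675, Kesten1963SAW, doi:10.1088/0305-4470/20/7/006,
doi:10.1088/0305-4470/25/11/016]
#3 YBLimitExists (crux) — (i) Every Dobrushin domain admits mid-edge endpoint approximations on the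
rhombic tiling of every angle α ∈ [π/3, 2π/3] (IsYBEndpointApprox; accessibility of prime ends + a
chain of δ-rhombi — the provable-now conjunct, the π/2 case being
SAWCompassLattice.CompassEndpoints), and (ii) the critical square-tiling Yang–Baxter walk has a
ROBUST FULL chordal scaling limit: there is a chordal family P (IsChordal) with RL(π/2) P — for
every Dobrushin domain, every family of sub-mesh translates and every admissible family of mid-edge
endpoints, `ybLaw (fun _ => π/2) (D + u_δ) δ 1 a_δ b_δ` pushed to curves converges in law to P D as
δ → 0⁺. The limit is NOT identified here (tightness + uniqueness of subsequential limits; all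
statements eventual in δ, no IsTightLaws — cf. negative stmt-CriticalPhenomena-0772). [difficulty:
open-problem] (why it might fail: no tightness theory for any critical SAW: eventual tightness needs
annulus-crossing bounds at x = 1 (bridge decay B_T → 0 of GM Thm 2 is the only input), uniqueness of
subsequential limits a full-filter statement; face revisits (weights w₁ = w₂ ≠ u²) complicate
surgery.) [GlazmanManolescu2019, KemppainenSmirnov2017, AizenmanBurchard1999,
DuminilCopinHammond2013, LawlerSchrammWerner2004SAW]
#4 AxiomsOfLimit (crux) — Every chordal family P that is the robust full limit of the critical
square-tiling Yang–Baxter walk (given that every Dobrushin domain admits a square-tiling endpoint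
approximation, so no value P D is unconstrained) is (i) translation covariant (lattice translations
are exact, sub-mesh remainders are absorbed by robustness), (ii) similarity covariant AS SOON AS it
is covariant under rotations about the origin (lattice scalings δ ↦ δ/λ are exact), (iii)
restriction–Markov (ChordalFamily.IsRestrictionMarkov), (iv) reversible, (v) covariant under complex
conjugation (exact mirror of the square tiling through 0), (vi) carried by simple curves meeting ∂D
only at the marked points. [deps: YBLimitExists] [difficulty: L] (why it might fail: restriction is
exact but domain-Markov is NOT exact for the face walk (a revisited face weighs w/u² ≈ 0.68,
coupling past and future), so (iii) needs irrelevance of revisits or the compass realisation; (vi)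
needs no macroscopic self-touching of a critical polymer, unproved.) [LawlerSchrammWerner2004SAW,
GlazmanManolescu2019, Werner2007, DuminilCopinHammond2013, KennedyLawler2013]
#5 RStarRot (crux) — R*_rot, VERBATIM the shared item stmt-CriticalPhenomena-7298 of route
SAWIsotropicAnchor: a chordal curve family on Dobrushin domains that is chordal, restriction–Markov
(ChordalFamily.IsRestrictionMarkov), reversible, covariant under ALL similarities z ↦ cz + w and
under complex conjugation, and carried by simple curves meeting ∂D only at the marked points, is
conformally covariant — hence SLE_(8/3) by LSW03. This route is a second supplier of its rotation
hypothesis. [difficulty: open-problem] (why it might fail: no technique known without a conformal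
structure: the Markov axiom relates laws in non-similar slit domains and nothing yet forces the only
consistent assignment D ↦ P_D to be the conformal one; a.e.-slack in the kernel may admit
choice-built exotic families.) [LawlerSchrammWerner2003Restriction, Beffara2008Universal,
Werner2007, Schramm2000, arXiv:math/0307353]
#6 YBtoUniform (crux) — YB → uniform ℤ² universality (conjunct-facing toll): for every Dobrushin
domain D, every δℤ² endpoint approximation (a_δ, b_δ) (SAW.IsEndpointApprox) and every square-tiling
Yang–Baxter endpoint approximation (a'_δ, b'_δ) (IsYBEndpointApprox at Θ ≡ π/2), and every bounded
continuous f on CurveClass ℂ, ∫ f∘curve dSAW.law(D)_δ − ∫ f∘(YBWalk.curve) d ybLaw(π/2)(D)_δ → 0 as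
δ → 0⁺. Same status and content as SAWCompassLattice.SurfaceUniversality (compass law = ybLaw on
port sequences by their PortDictionary) and retired SAWHexUniversality r4; this route adds no
mechanism here beyond theirs (motion along the D4-symmetric critical surface of the compass ∪ plus
lattice). [difficulty: open-problem] (why it might fail: no tool proves irrelevance of a
D4-symmetric local reweighting (straight-vertex weight v/u ≈ 0.785, revisit weight w/u² ≈ 0.68) at a
non-Gaussian fixed point; a collapse-type transition along the interpolation would separate the two
laws.) [GlazmanManolescu2019, Glazman2015WeightedSAW, Beffara2008Universal, KennedyLawler2013,
MadrasSlade1993, Literature.Barriers.CriticalPhenomena.NienhuisWeightsExcludeVertexSAW]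
#7 MirrorRotation (crux) — THE REFLECTION TRICK (DKKMO2020Rotational §7, case ℝ², transposed to
chordal families; a crux because the deciding theorem consumes it and it is not yet a lemma):
AngleUniversality, existence of endpoint approximations at every angle α ∈ [π/3, 2π/3], and a robust
full square limit P give covariance of P under every rotation about the origin. Proof plan: the
rhombic tiling of angle α (corners −i/2 + ℤi + ℤ(sin α − i cos α)) is mapped to itself, weights and
meshFaces included, by the mirror across the line through −i/2 in direction e^(iα/2); so
ybLaw_α(σ'_δ D) = (σ'_δ)_* ybLaw_α(D) exactly, with σ'_δ → σ_(α/2) and σ'_δ D = σ_(α/2) D + u_δ,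
‖u_δ‖ ≤ δ (robustness absorbs u_δ); AU makes the α-laws converge to P, so P(σ_(α/2) D) = (σ_(α/2))_*
P(D); the square tiling gives conjugation covariance exactly; σ_(α/2) ∘ σ_(α'/2) is the rotation by
α − α', an interval of angles, and finitely many of those compose to any rotation (no closure
argument needed). [deps: AngleUniversality, YBLimitExists] [difficulty: M] (why it might fail:
formalisation-level: the mirror through −i/2 misses the origin by δ/2 (hence the sub-mesh shifts in
RL); a Slutsky-type perturbation lemma for TendstoLaw and the combinatorial mirror automorphism of
GM's face walk are needed; an embedding slip falsifies it as typed.) [DKKMO2020Rotational,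
GlazmanManolescu2019]
#9 LSW2003Characterisation (support) — VERBATIM the shared item stmt-CriticalPhenomena-8230 (route
SAWIsotropicAnchor): Lawler–Schramm–Werner 2003 — a chordal family that is conformally covariant,
has two-sided restriction and is carried by simple curves meeting ∂D only at the marked points is,
in every Dobrushin domain, the chordal SLE_(8/3) law; = the Literature named fact
LawlerSchrammWerner2003, PROVED in tree (LawlerSchrammWerner2003_holds); the deciding theorem
invokes that proved theorem directly (import ConformalRestrictionHolds), so this support is
documentation of the shared dependency, not a hypothesis. [difficulty: provable-now]
[LawlerSchrammWerner2003Restriction]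
#9 ArchTransport (support) — ARCH TRANSPORT in Glazman–Manolescu's own half-plane H(Θ) (the n = 0
analogue of DKKMO Thm 2.1 in infinite volume; where provers should start and where the zero-drift
identity lives): for every α ∈ [π/3, 2π/3] and reals A < B, the critical Yang–Baxter ARCH law —
walks of the half-plane of faces `halfPlane` from `boundaryPoint ⌊A/δ⌋` to `boundaryPoint ⌊B/δ⌋`,
weight w_Θ(γ), normalised, pushed to CurveClass ℂ by `YBWalk.curve Θ δ` — for Θ ≡ π/2 and for Θ ≡ α
differ by o(1) on every bounded continuous test function as δ → 0⁺ (same boundary points: the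
boundary column and its unit vertical edges are common to all angle sequences; total masses are
equal and finite by GM Thm 1 and Cor. 2.3, so both laws are probability measures — GM Theorem 1
upgraded from the mass to the law of the curve). [difficulty: open-problem] [GlazmanManolescu2019,
DKKMO2020Rotational]

TWO-LAYER PLAN. AngleUniversality ⇐ ZeroDrift → PolygonTransport → AngleUniversality: ZeroDrift
(filed informal at open, to be typed once the apex-pinned two-sided Yang–Baxter walk / the cylinder
transfer matrix in the m-strand sector is defined) = "when a column of angle α is exchanged through
columns of angle β past the deepest point of the apex-pinned two-sided critical walk, the deepest
point ends on the far line with probability sin α/(sin α + sin β)" (⇐ commuting column transfer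
matrices, exact by Yang–Baxter, + lim N·log(λ_N^(m)(θ)/λ_N^(m+2)(θ)) = C_m·sin θ); PolygonTransport
= ArchTransport's full-plane twin for the critical Yang–Baxter POLYGON gas (no endpoints, so every
column is exchangeable and the domain class is mirror-closed) with the curve's own mesoscopic
sub-arc extrema as DKKMO's marked nails; the glue passes to bounded Dobrushin domains by exact
restriction/cutting (cf. route SAWLoopLift's BoundaryMixing) and to chords. AxiomsOfLimit ⇐
RevisitIrrelevance (face revisits do not affect the limit; or transport to SAWCompassLattice's
honest compass SAW by its PortDictionary, where slit-domain Markov is exact) → SimpleLimits →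
AxiomsOfLimit. Nothing filed now.

KILL CRITERIA. ¬AngleUniversality at any single α (an angle-dependent limit of the isoradially
embedded walk, e.g. a Θ-dependent left-passage probability) closes the route outright (close
--reason refuted:AngleUniversality) and refutes universality of the n = 0 Yang–Baxter family at the
level of curves — news in itself. A numerical or Bethe-ansatz DISPROOF of the sin θ-proportionality
of the n = 0 gaps (ZeroDrift false) kills the engine and forces a pivot to ArchTransport by other
means or retirement. ¬YBtoUniform with the rest proved converts the route into "the Yang–Baxter SAW
converges to SLE_(8/3)" (retire as exhausted for the conjunct; evidence against universality on ℤ²).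
¬RStarRot (an exotic similarity-covariant restriction–Markov family) breaks this route together with
SAWIsotropicAnchor; pivot: strengthen the symmetry input (the transport gives covariance under the
mirrors too) or import SAWRestrictionRigidity's D4 form. RStarRot or YBtoUniform proved elsewhere
are shared items and simply close here.

NOT DECOMPOSED YET. The zero-drift identity as a typed lattice statement (needs a definition:
cylinder/torus Yang–Baxter walks with m non-contractible strands and their column transfer matrix,
or the apex-pinned infinite two-sided walk as a ratio limit) — filed informal; the single-curve
version of DKKMO's nail/homotopy bookkeeping (Thm 2.2 analogue: sub-arc extrema in three directions
on an η-grid determine a simple curve to precision κ); the a-priori inputs replacing RSW (separation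
of competing extrema of a critical arch, no ties at mesoscopic distance; bridge decay B_T → 0 as the
confinement input); the passage infinite volume → Dobrushin domains (polygon gas + cutting, or
arches + exact restriction with boundary continuity); the mirror/translation/scaling equivariance
lemmas of ybLaw and the Slutsky-type perturbation lemma for TendstoLaw inside MirrorRotation and
AxiomsOfLimit(i)-(ii); everything inside RStarRot and YBtoUniform (other routes' business).

CHEAPEST FALSIFIER. The n = 0 gap-anisotropy test behind ZeroDrift, by exact transfer matrices (a
kit job of minutes): build the column transfer matrix of the Glazman–Manolescu walk (local weights
1, u₁, u₂, v, w₁, w₂ of GM eq. (1) = `weightU1 … weightW2`) on a cylinder of N = 4…9 rhombi in the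
sectors with m = 1, 2, 3 through-strands, compute the Perron eigenvalues λ_N^(m)(θ) for θ ∈ {π/3,
5π/12, π/2, 7π/12, 2π/3}, and test whether N·log(λ_N^(m)(θ)/λ_N^(m+2)(θ)) / sin θ is θ-INDEPENDENT
as N grows (CFT/Kim–Pearce predict (2π)(x_(m+2) − x_m) with the n = 0 watermelon exponents x_L =
(9L² − 4)/48, e.g. x_3 − x_1 = 3/2). A θ-dependence of the ratio beyond finite-size drift kills
ZeroDrift, hence the engine of AngleUniversality. Not run in this planning cycle (needs the m-strand
connectivity transfer matrix to be coded; recorded for the refuter/kit). Lookup-level falsifier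
already passed: DKKMO's scheme uses FKG/RSW only for (a) existence of the IIC-type local limit and
(b) separation of arms — for one SAW curve (a) becomes a Kesten-type ratio limit and (b) a no-ties
estimate, neither known false; the coupling itself (GM §3) and the torus commutation are exact at n
= 0.

NUMBERS. Yang–Baxter weights at θ = π/2 (GlazmanManolescu2019 eq. (1);
Literature.Barriers.CriticalPhenomena.NienhuisWeightsExcludeVertexSAW): u₁ = u₂ = 0.408390934, v =
0.320870698, w₁ = w₂ = 0.112674805; revisit penalty w/u² ≈ 0.675, straight penalty v/u ≈ 0.785;
1/u₁(π/2) = 2.448… < μ(ℤ²) ≈ 2.638 (Glazman 2015 p. 3). Zero-drift value sin α/(sin α + sin β) =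
ratio of column widths (colShift = (sin θ, −cos θ)). n = 0 exponents the gaps are measured against:
x_1 = 5/48, x_2 = 2/3 (= 2 − 1/ν, ν = 3/4), boundary 1-leg 5/8, κ = 8/3. Angle range [π/3, 2π/3] =
positivity range of the weights (w₂(π/3) = w₁(2π/3) = 0); mirrors at α/2 ∈ [π/6, π/3] give rotations
by α − α' ∈ [−π/3, π/3].

DEFINITION REQUESTS. (1) `YBCylinderTransferMatrix` — the column-to-column transfer matrix of the
Glazman–Manolescu walk on a cylinder ℤ/Nℤ of rhombi of angle θ in the sector with m through-strands
(states: occupied vertical mid-edges with a non-crossing partial pairing and strand labels), topic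
Literature/Probability/RandomPlanarGeometry — needed to type ZeroDrift / GapAnisotropy. (2)
`YBPolygon` / critical Yang–Baxter polygon measure of the whole-plane tiling (closed GM walks), same
topic — needed to type PolygonTransport. (3) cite fact wanted: DKKMO2020Rotational Thm 2.4/Prop 2.5
(FK zero drift) and arXiv:2012.11675 Thm (six-vertex gaps) as Literature named facts for the
transplant's dictionary. To be filed with `ledger workitem add --kind definition` after open.

Novelty: Searches (2026-08-16): `lit search "Rotational invariance in critical planar lattice models"
--source arxiv` (3: arXiv:2012.11672 DKKMO, arXiv:2603.16318 Manolescu–Mohanarangan Wulff crystal, 1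
irrelevant); `lit citing arxiv:2012.11672 --source api` (27 citing works 2020–2026:
FK/Potts/six-vertex/CLE/GFF — none on SAW or loop O(n) rotation); `lit citing
doi:10.1214/19-aihp1024` (GM2019 cited by 2: arXiv:1809.00760 Hammersley–Welsh with polygon
insertion, arXiv:1804.05380 weighted SAW — no curve-law universality); `lit search … --source arxiv`
for "loop O(n) model isoradial universality star-triangle", "self-avoiding walk Yang-Baxter weights
rotational invariance", "dilute O(n) model rotation invariance scaling limit" (0, 0, 0); `lit search
"self-avoiding walk Yang-Baxter weights universality" --source crossref` (6: GM2019, Trovato–Seno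
1997 transfer matrices, Madras–Slade); `lit galaxy search "Yang-Baxter self-avoiding walk" / "track
exchange self-avoiding" / "Yang-Baxter weights" --star all` (0, 0, 0); `lit galaxy search
"Izergin-Korepin" --star all` (20 integrability hits, none on SAW scaling limits); full read of
arXiv:2012.11672 pp. 1–12, 42–43 (materialised); tree: all 58 open route theses + headers of
SAWCompassLattice, SAWBrickWallHomotopy, SAWIsotropicAnchor, SAWLoopLift, retired
SAWHexUniversality, YangBaxterSAW(Law).lean, barrier files; `ledger negatives --problem
CriticalPhenomena` (10). OpenAlex/S2 rate-limited today (HTTP 429).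
Nearest prior art found: DKKMO2020R  [refs: 10.1214/19-aihp1024`, 2012.11672, 2603.16318, 1809.00760, 1804.05380, 1708.00395, arxiv:2012.11672, doi:10.1214/19-aihp1024, GlazmanManolescu2019]

Barriers (technique_class: yang-baxter track-transport, zero-drift, symmetry-upgrade): - technique_class: yang-baxter track-transport, zero-drift, symmetry-upgrade
- Literature.Barriers.CriticalPhenomena.ParafermionicHalfCauchyRiemann: evaded — no observable, no
vertex relation, no Riemann–Hilbert problem is used; integrability enters as a measure-preserving
COUPLING (GM §3) and as a spectral identity on the cylinder, exactly the two uses that gave DKKMO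
rotation invariance for FK with q ≠ 2 where the same half-holomorphicity obstruction holds.
- Literature.Barriers.CriticalPhenomena.NienhuisWeightsExcludeVertexSAW: it applies in full — the
transported model is the Nienhuis/Glazman–Manolescu face walk, not the uniform vertex SAW of the
conjunct (PROVED weight comparison); not evaded: the bet is the separate universality crux
YBtoUniform (shared in content with SAWCompassLattice.SurfaceUniversality, whose compass gadget
makes both ends honest SAWs on one D4-symmetric lattice).
- Literature.Barriers.CriticalPhenomena.EmbeddingModulusUniqueness: evaded — Beffara's obstruction
is to embedding-BLIND rescaling arguments (limit known only modulo a linear map); track transport is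
embedding-AWARE: the coupling lives in the isoradial embedding and the zero-drift identity is
precisely the statement that the lattice displacements match the isoradial geometry (column widths
sin θ), so no modulus is left (as in DKKMO, where the same barrier is cited and passed).
- Literature.Barriers.CriticalPhenomena.ScaleCovarianceNotMoebius: applies to the upgrade step in
MODEL-BLIND form

History (route lifecycle, newest last):
- 2026-08-16T21:52:14Z · rev 1: restated YBLimitExists (stmt-CriticalPhenomena-16964), Assembly (stmt-CriticalPhenomena-16970) — crux-only deciding theorem: RotationFromAngles(support)→MirrorRotation(crux r7); endpoint approximations folded into YBLimitExists; LSW via proved Literature th (planner-plan-novel-CriticalPhenomena-SAWScaling-8a38611a-v2-)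
- 2026-08-16T21:52:14Z · rev 1: dropped RotationFromAngles, YBApproxExists — crux-only deciding theorem: RotationFromAngles(support)→MirrorRotation(crux r7); endpoint approximations folded into YBLimitExists; LSW via proved Literature th (planner-plan-novel-CriticalPhenomena-SAWScaling-8a38611a-v2-)
- 2026-08-16T22:03:14Z · rev 2: restated Assembly (stmt-CriticalPhenomena-16996) — route-repair (cone, rrepair 76075f27, 2026-08-16): RE-ROUTED AROUND 17 of the 34 module-cone facts — `import Literature.Probability.RandomPlanarGeometry.Conform (planner-rrepair-CriticalPhenomena-SAWTrackTran-76075f27-0)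
- 2026-08-16T22:06:08Z · rev 3: restated Assembly (stmt-CriticalPhenomena-17010) — route-repair (cone, rrepair 76075f27) rev 3 = REVERT of rev 2 to the rev-1 shape: crux-only `closes (h2 AngleUniversality) (h3 YBLimitExists) (h4 AxiomsOfLimit) (planner-rrepair-CriticalPhenomena-SAWTrackTran-76075f27-0)
- 2026-08-24T07:10:32Z · DORMANT — reconciler: no traction for 6.6 d (last activity item-evidence-added at 2026-08-17T16:45:29Z); parked, not closed — `ledger route dormant route-CriticalPhenomen (operator:999:4085301)

sub-problem: SAWScalingLimit · status: dormant · opened planner-plan-novel-CriticalPhenomena-SAWScaling-8a38611a-v2-g9-0 2026-08-16T21:49:22Z · rev 3 · ledger route-CriticalPhenomena-SAWTrackTransport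
GENERATED by the gate from the ledger (D-0016/17). Provers cite these decls: `theorem foo : Summit.CriticalPhenomena.SAWScalingLimit.Theses.SAWTrackTransport.<Decl> := …` in Summits/CriticalPhenomena/SAWScalingLimit/Theorems/<Name>.lean.
-/

namespace Summit.CriticalPhenomena.SAWScalingLimit.Theses.SAWTrackTransport

open scoped BigOperators Topology Manifold Classical MeasureTheory ProbabilityTheory Matrix InnerProductSpace ComplexConjugate ContinuousMap
open Filter Set Function TopologicalSpace MeasureTheory

attribute [summit_statement] _root_.SAWScalingLimit

/-- item stmt-CriticalPhenomena-16963 · crux · rank 2 · open · by planner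
why it might fail: zero drift at n = 0 needs sin θ-proportional gaps of the dilute-O(0) (Izergin–Korepin) column transfer matrix — Bethe-ansatz level, unproved; without RSW, separation of competing extrema and the apex-pinned infinite walk (Kesten ratio limits) may fail.
sources: DKKMO2020Rotational, GlazmanManolescu2019, Glazman2015WeightedSAW, arXiv:2012.11675, Kesten1963SAW, doi:10.1088/0305-4470/20/7/006
[crux] For every α ∈ [π/3, 2π/3] and every chordal family P: if P is the ROBUST FULL LIMIT of the
critical (x = 1) Glazman–Manolescu Yang–Baxter walk on the square tiling (RL(π/2) P: for every
Dobrushin domain D, every family of sub-mesh translates D + u_δ, ‖u_δ‖ ≤ δ, and every family of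
mid-edge endpoints joined in (D + u_δ)_δ whose rescaled midpoints tend to the marked points, the law
`ybLaw (π/2) (D + u_δ) δ 1 a_δ b_δ` pushed to `CurveClass ℂ` by `YBWalk.curve` converges in law to P
D), then P is also the robust full limit RL(α) P of the critical Yang–Baxter walk on the rhombic
tiling of constant angle α, curves drawn in the isoradial embedding `planeMidpoint (fun _ => α)`.
Intended proof = DKKMO's scheme at n = 0: Glazman–Manolescu column exchanges bring α-columns through
π/2-columns as a coupling of walks; per exchange the curve moves O(δ); the accumulated displacement
of its mesoscopic sub-arc extrema is o(1) by the n = 0 ZERO-DRIFT identity (filed informal: apex of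
the pinned two-sided walk jumps to the far line with probability sin α/(sin α + sin β)); passage to
bounded domains through the full-plane critical polygon gas / exact restriction. [difficulty:
open-problem] -/
@[route_item "route-CriticalPhenomena-SAWTrackTransport", crux]
def AngleUniversality : Prop :=
  open MeasureTheory Filter Literature.Probability.RandomPlanarGeometry Literature.Probability.RandomPlanarGeometry.SAW.YangBaxter in let RL : ℝ → ChordalFamily → Prop := fun α P => ∀ (D : DobrushinDomain) (u : ℝ → ℂ) (a b : ℝ → MidEdge), (∀ᶠ δ in 𝓝[>] (0 : ℝ), ‖u δ‖ ≤ δ) → (∀ᶠ δ in 𝓝[>] (0 : ℝ), Nonempty (YangBaxterSAW (fun (_ : ℤ) => α) ((D.map (similarity 1 one_ne_zero (u δ))).carrier) δ (a δ) (b δ))) → Tendsto (fun δ : ℝ => (δ : ℂ) * planeMidpoint (fun (_ : ℤ) => α) (a δ)) (𝓝[>] (0 : ℝ)) (𝓝 (D.pt 0)) → Tendsto (fun δ : ℝ => (δ : ℂ) * planeMidpoint (fun (_ : ℤ) => α) (b δ)) (𝓝[>] (0 : ℝ)) (𝓝 (D.pt 1)) → TendstoLaw (fun δ (γ : YangBaxterSAW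 (fun (_ : ℤ) => α) ((D.map (similarity 1 one_ne_zero (u δ))).carrier) δ (a δ) (b δ)) => γ.curve (fun (_ : ℤ) => α) δ) (fun δ => ybLaw (fun (_ : ℤ) => α) ((D.map (similarity 1 one_ne_zero (u δ))).carrier) δ 1 (a δ) (b δ)) id (P D); ∀ α ∈ Set.Icc (Real.pi / 3) (2 * Real.pi / 3), ∀ P : ChordalFamily, P.IsChordal → RL (Real.pi / 2) P → RL α P

-- earlier YBLimitExists (stmt-CriticalPhenomena-16964, replaced 2026-08-16T21:52:14Z -> stmt-CriticalPhenomena-16995): retired by None — open MeasureTheory Filter Literature.Probability.RandomPlanarGeometry Literature.Probability.RandomPlanarGeometry.SAW.YangBaxter in let RL : ℝ → ChordalFamily → Prop := fun α P => ∀ (D : DobrushinDomain) (u : ℝ → ℂ) (a b : ℝ → MidEdge), (∀ᶠ δ in 𝓝[>] (0 : ℝ), ‖u δ‖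
/-- item stmt-CriticalPhenomena-16995 · crux · rank 3 · open · by planner
why it might fail: no tightness theory for any critical SAW: eventual tightness needs annulus-crossing bounds at x = 1 (bridge decay B_T → 0 of GM Thm 2 is the only input), uniqueness of subsequential limits a full-filter statement; face revisits (weights w₁ = w₂ ≠ u²) complicate surgery.
sources: GlazmanManolescu2019, KemppainenSmirnov2017, AizenmanBurchard1999, DuminilCopinHammond2013, LawlerSchrammWerner2004SAW
[crux] (i) Every Dobrushin domain admits mid-edge endpoint approximations on the rhombic tiling of
every angle α ∈ [π/3, 2π/3] (IsYBEndpointApprox; accessibility of prime ends + a chain of δ-rhombi —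
the provable-now conjunct, the π/2 case being SAWCompassLattice.CompassEndpoints), and (ii) the
critical square-tiling Yang–Baxter walk has a ROBUST FULL chordal scaling limit: there is a chordal
family P (IsChordal) with RL(π/2) P — for every Dobrushin domain, every family of sub-mesh
translates and every admissible family of mid-edge endpoints, `ybLaw (fun _ => π/2) (D + u_δ) δ 1
a_δ b_δ` pushed to curves converges in law to P D as δ → 0⁺. The limit is NOT identified here
(tightness + uniqueness of subsequential limits; all statements eventual in δ, no IsTightLaws — cf.
negative stmt-CriticalPhenomena-0772). [difficulty: open-problem] -/
@[route_item "route-CriticalPhenomena-SAWTrackTransport", crux]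
def YBLimitExists : Prop :=
  open MeasureTheory Filter Literature.Probability.RandomPlanarGeometry Literature.Probability.RandomPlanarGeometry.SAW.YangBaxter in let RL : ℝ → ChordalFamily → Prop := fun α P => ∀ (D : DobrushinDomain) (u : ℝ → ℂ) (a b : ℝ → MidEdge), (∀ᶠ δ in 𝓝[>] (0 : ℝ), ‖u δ‖ ≤ δ) → (∀ᶠ δ in 𝓝[>] (0 : ℝ), Nonempty (YangBaxterSAW (fun (_ : ℤ) => α) ((D.map (similarity 1 one_ne_zero (u δ))).carrier) δ (a δ) (b δ))) → Tendsto (fun δ : ℝ => (δ : ℂ) * planeMidpoint (fun (_ : ℤ) => α) (a δ)) (𝓝[>] (0 : ℝ)) (𝓝 (D.pt 0)) → Tendsto (fun δ : ℝ => (δ : ℂ) * planeMidpoint (fun (_ : ℤ) => α) (b δ)) (𝓝[>] (0 : ℝ)) (𝓝 (D.pt 1)) → TendstoLaw (fun δ (γ : YangBaxterSAW (fun (_ : ℤ) => α) ((D.map (similarity 1 one_ne_zero (u δ))).carrier) δ (a δ) (b δ)) => γ.curve (fun (_ : ℤ) => α) δ) (fun δ => ybLaw (fun (_ : ℤ) =>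 α) ((D.map (similarity 1 one_ne_zero (u δ))).carrier) δ 1 (a δ) (b δ)) id (P D); (∀ α ∈ Set.Icc (Real.pi / 3) (2 * Real.pi / 3), ∀ D : DobrushinDomain, ∃ a b : ℝ → MidEdge, IsYBEndpointApprox (fun (_ : ℤ) => α) D a b) ∧ ∃ P : ChordalFamily, P.IsChordal ∧ RL (Real.pi / 2) P

/-- item stmt-CriticalPhenomena-16965 · crux · rank 4 · open · by planner
why it might fail: restriction is exact but domain-Markov is NOT exact for the face walk (a revisited face weighs w/u² ≈ 0.68, coupling past and future), so (iii) needs irrelevance of revisits or the compass realisation; (vi) needs no macroscopic self-touching of a critical polymer, unproved.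
sources: LawlerSchrammWerner2004SAW, GlazmanManolescu2019, Werner2007, DuminilCopinHammond2013, KennedyLawler2013
[crux] Every chordal family P that is the robust full limit of the critical square-tiling
Yang–Baxter walk (given that every Dobrushin domain admits a square-tiling endpoint approximation,
so no value P D is unconstrained) is (i) translation covariant (lattice translations are exact,
sub-mesh remainders are absorbed by robustness), (ii) similarity covariant AS SOON AS it is
covariant under rotations about the origin (lattice scalings δ ↦ δ/λ are exact), (iii)
restriction–Markov (ChordalFamily.IsRestrictionMarkov), (iv) reversible, (v) covariant under complex
conjugation (exact mirror of the square tiling through 0), (vi) carried by simple curves meeting ∂D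
only at the marked points. [deps: YBLimitExists] [difficulty: L] -/
@[route_item "route-CriticalPhenomena-SAWTrackTransport", crux]
def AxiomsOfLimit : Prop :=
  open MeasureTheory Filter Literature.Probability.RandomPlanarGeometry Literature.Probability.RandomPlanarGeometry.SAW.YangBaxter in let RL : ℝ → ChordalFamily → Prop := fun α P => ∀ (D : DobrushinDomain) (u : ℝ → ℂ) (a b : ℝ → MidEdge), (∀ᶠ δ in 𝓝[>] (0 : ℝ), ‖u δ‖ ≤ δ) → (∀ᶠ δ in 𝓝[>] (0 : ℝ), Nonempty (YangBaxterSAW (fun (_ : ℤ) => α) ((D.map (similarity 1 one_ne_zero (u δ))).carrier) δ (a δ) (b δ))) → Tendsto (fun δ : ℝ => (δ : ℂ) * planeMidpoint (fun (_ : ℤ) => α) (a δ)) (𝓝[>] (0 : ℝ)) (𝓝 (D.pt 0)) → Tendsto (fun δ : ℝ => (δ : ℂ) * planeMidpoint (fun (_ : ℤ) => α) (b δ)) (𝓝[>] (0 : ℝ)) (𝓝 (D.pt 1)) → TendstoLaw (fun δ (γ : YangBaxterSAW (fun (_ : ℤ) => α) ((D.map (similarity 1 one_ne_zero (u δ))).carrier)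 δ (a δ) (b δ)) => γ.curve (fun (_ : ℤ) => α) δ) (fun δ => ybLaw (fun (_ : ℤ) => α) ((D.map (similarity 1 one_ne_zero (u δ))).carrier) δ 1 (a δ) (b δ)) id (P D); ∀ P : ChordalFamily, P.IsChordal → (∀ D : DobrushinDomain, ∃ a b : ℝ → MidEdge, IsYBEndpointApprox (fun (_ : ℤ) => Real.pi / 2) D a b) → RL (Real.pi / 2) P → (∀ (D : DobrushinDomain) (w : ℂ), P (D.map (similarity 1 one_ne_zero w)) = (P D).map (CurveClass.map (similarity 1 one_ne_zero w : C(ℂ, ℂ)))) ∧ ((∀ (D : DobrushinDomain) (c : ℂ) (hc : c ≠ 0), ‖c‖ = 1 → P (D.map (similarity c hc 0)) = (P D).map (CurveClass.map (similarity c hc 0 : C(ℂ, ℂ)))) → P.IsSimilarityCovariant) ∧ P.IsRestrictionMarkov ∧ P.IsReversible ∧ (∀ D : DobrushinDomain, P (D.map Complex.conjLIE.toHomeomorph) = (P D).map (CurveClass.map (Complex.conjLIE.toHomeomorph : C(ℂ, ℂ)))) ∧ (∀ D : DobrushinDomain, ∀ᵐ γ ∂(P D), γ ∈ CurveClass.simple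 ∧ γ.range ∩ frontier D.carrier ⊆ {D.pt 0, D.pt 1})

/-- item stmt-CriticalPhenomena-7298 · crux · rank 5 · open · by planner
why it might fail: no technique known without a conformal structure: the Markov axiom relates laws in non-similar slit domains and nothing yet forces the only consistent assignment D ↦ P_D to be the conformal one; a.e.-slack in the kernel may admit choice-built exotic families.
sources: LawlerSchrammWerner2003Restriction, Beffara2008Universal, Werner2007, Schramm2000, arXiv:math/0307353
[crux] R*_rot (card V3; rotation-invariant special case of Rigidity stmt-CriticalPhenomena-1368): a
chordal curve family on Dobrushin domains that is chordal, has the restriction-coupled domain Markov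
property (ChordalFamily.IsRestrictionMarkov), is reversible (ChordalFamily.IsReversible), is
covariant under ALL similarities z ↦ cz + w (ChordalFamily.IsSimilarityCovariant) and under complex
conjugation, and is carried by simple curves meeting ∂D only at the marked points, is conformally
covariant (ChordalFamily.IsConformallyCovariant) — hence SLE_{8/3} by LSW03. [difficulty:
open-problem] -/
@[route_item "route-CriticalPhenomena-SAWTrackTransport", crux]
def RStarRot : Prop :=
  ∀ P : Literature.Probability.RandomPlanarGeometry.ChordalFamily, P.IsChordal → P.IsRestrictionMarkov → P.IsReversible → P.IsSimilarityCovariant → (∀ D : Literature.Probability.RandomPlanarGeometry.DobrushinDomain, P (D.map Complex.conjLIE.toHomeomorph) = (P D).map (Literature.Probability.RandomPlanarGeometry.CurveClass.map (Complex.conjLIE.toHomeomorph : C(ℂ, ℂ)))) → (∀ D : Literature.Probability.RandomPlanarGeometry.DobrushinDomain, ∀ᵐ γ ∂(P D), γ ∈ Literature.Probability.RandomPlanarGeometry.CurveClass.simple ∧ γ.range ∩ frontier D.carrier ⊆ {D.pt 0, D.pt 1}) → P.IsConformallyCovariant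

/-- item stmt-CriticalPhenomena-16966 · crux · rank 6 · open · by planner
why it might fail: no tool proves irrelevance of a D4-symmetric local reweighting (straight-vertex weight v/u ≈ 0.785, revisit weight w/u² ≈ 0.68) at a non-Gaussian fixed point; a collapse-type transition along the interpolation would separate the two laws.
sources: GlazmanManolescu2019, Glazman2015WeightedSAW, Beffara2008Universal, KennedyLawler2013, MadrasSlade1993, Literature.Barriers.CriticalPhenomena.NienhuisWeightsExcludeVertexSAW
[crux] YB → uniform ℤ² universality (conjunct-facing toll): for every Dobrushin domain D, every δℤ²
endpoint approximation (a_δ, b_δ) (SAW.IsEndpointApprox) and every square-tiling Yang–Baxter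
endpoint approximation (a'_δ, b'_δ) (IsYBEndpointApprox at Θ ≡ π/2), and every bounded continuous f
on CurveClass ℂ, ∫ f∘curve dSAW.law(D)_δ − ∫ f∘(YBWalk.curve) d ybLaw(π/2)(D)_δ → 0 as δ → 0⁺. Same
status and content as SAWCompassLattice.SurfaceUniversality (compass law = ybLaw on port sequences
by their PortDictionary) and retired SAWHexUniversality r4; this route adds no mechanism here beyond
theirs (motion along the D4-symmetric critical surface of the compass ∪ plus lattice). [difficulty:
open-problem] -/
@[route_item "route-CriticalPhenomena-SAWTrackTransport", crux]
def YBtoUniform : Prop :=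
  open MeasureTheory Filter Literature.Probability.RandomPlanarGeometry Literature.Probability.RandomPlanarGeometry.SAW.YangBaxter in ∀ (D : DobrushinDomain) (a b : ℝ → Literature.Probability.LatticeModels.Site 2) (a' b' : ℝ → MidEdge), SAW.IsEndpointApprox D a b → IsYBEndpointApprox (fun (_ : ℤ) => Real.pi / 2) D a' b' → ∀ f : BoundedContinuousFunction (CurveClass ℂ) ℝ, Tendsto (fun δ : ℝ => (∫ γ, f γ.curve ∂(SAW.law D.carrier δ (a δ) (b δ))) - ∫ γ, f (γ.curve (fun (_ : ℤ) => Real.pi / 2) δ) ∂(ybLaw (fun (_ : ℤ) => Real.pi / 2) D.carrier δ 1 (a' δ) (b' δ))) (𝓝[>] (0 : ℝ)) (𝓝 0)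

/-- item stmt-CriticalPhenomena-16997 · crux · rank 7 · open · by planner
why it might fail: formalisation-level: the mirror through −i/2 misses the origin by δ/2 (hence the sub-mesh shifts in RL); a Slutsky-type perturbation lemma for TendstoLaw and the combinatorial mirror automorphism of GM's face walk are needed; an embedding slip falsifies it as typed.
sources: DKKMO2020Rotational, GlazmanManolescu2019
[crux] THE REFLECTION TRICK (DKKMO2020Rotational §7, case ℝ², transposed to chordal families; a crux
because the deciding theorem consumes it and it is not yet a lemma): AngleUniversality, existence of
endpoint approximations at every angle α ∈ [π/3, 2π/3], and a robust full square limit P give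
covariance of P under every rotation about the origin. Proof plan: the rhombic tiling of angle α
(corners −i/2 + ℤi + ℤ(sin α − i cos α)) is mapped to itself, weights and meshFaces included, by the
mirror across the line through −i/2 in direction e^(iα/2); so ybLaw_α(σ'_δ D) = (σ'_δ)_* ybLaw_α(D)
exactly, with σ'_δ → σ_(α/2) and σ'_δ D = σ_(α/2) D + u_δ, ‖u_δ‖ ≤ δ (robustness absorbs u_δ); AU
makes the α-laws converge to P, so P(σ_(α/2) D) = (σ_(α/2))_* P(D); the square tiling gives
conjugation covariance exactly; σ_(α/2) ∘ σ_(α'/2) is the rotation by α − α', an interval of angles,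
and finitely many of those compose to any rotation (no closure argument needed). [deps:
AngleUniversality, YBLimitExists] [difficulty: M] -/
@[route_item "route-CriticalPhenomena-SAWTrackTransport", crux]
def MirrorRotation : Prop :=
  open MeasureTheory Filter Literature.Probability.RandomPlanarGeometry Literature.Probability.RandomPlanarGeometry.SAW.YangBaxter in let RL : ℝ → ChordalFamily → Prop := fun α P => ∀ (D : DobrushinDomain) (u : ℝ → ℂ) (a b : ℝ → MidEdge), (∀ᶠ δ in 𝓝[>] (0 : ℝ), ‖u δ‖ ≤ δ) → (∀ᶠ δ in 𝓝[>] (0 : ℝ), Nonempty (YangBaxterSAW (fun (_ : ℤ) => α) ((D.map (similarity 1 one_ne_zero (u δ))).carrier) δ (a δ) (b δ))) → Tendsto (fun δ : ℝ => (δ : ℂ) * planeMidpoint (fun (_ : ℤ) => α) (a δ)) (𝓝[>] (0 : ℝ)) (𝓝 (D.pt 0)) → Tendsto (fun δ : ℝ => (δ : ℂ) * planeMidpoint (fun (_ : ℤ) => α) (b δ)) (𝓝[>] (0 : ℝ)) (𝓝 (D.pt 1)) → TendstoLaw (fun δ (γ : YangBaxterSAW (fun (_ : ℤ) => α) ((D.map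 (similarity 1 one_ne_zero (u δ))).carrier) δ (a δ) (b δ)) => γ.curve (fun (_ : ℤ) => α) δ) (fun δ => ybLaw (fun (_ : ℤ) => α) ((D.map (similarity 1 one_ne_zero (u δ))).carrier) δ 1 (a δ) (b δ)) id (P D); AngleUniversality → (∀ α ∈ Set.Icc (Real.pi / 3) (2 * Real.pi / 3), ∀ D : DobrushinDomain, ∃ a b : ℝ → MidEdge, IsYBEndpointApprox (fun (_ : ℤ) => α) D a b) → ∀ P : ChordalFamily, P.IsChordal → RL (Real.pi / 2) P → ∀ (D : DobrushinDomain) (c : ℂ) (hc : c ≠ 0), ‖c‖ = 1 → P (D.map (similarity c hc 0)) = (P D).map (CurveClass.map (similarity c hc 0 : C(ℂ, ℂ)))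

/-- item stmt-CriticalPhenomena-16969 · support · rank 9 · open · by planner
sources: GlazmanManolescu2019, DKKMO2020Rotational
[support] ARCH TRANSPORT in Glazman–Manolescu's own half-plane H(Θ) (the n = 0 analogue of DKKMO Thm
2.1 in infinite volume; where provers should start and where the zero-drift identity lives): for
every α ∈ [π/3, 2π/3] and reals A < B, the critical Yang–Baxter ARCH law — walks of the half-plane
of faces `halfPlane` from `boundaryPoint ⌊A/δ⌋` to `boundaryPoint ⌊B/δ⌋`, weight w_Θ(γ), normalised,
pushed to CurveClass ℂ by `YBWalk.curve Θ δ` — for Θ ≡ π/2 and for Θ ≡ α differ by o(1) on every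
bounded continuous test function as δ → 0⁺ (same boundary points: the boundary column and its unit
vertical edges are common to all angle sequences; total masses are equal and finite by GM Thm 1 and
Cor. 2.3, so both laws are probability measures — GM Theorem 1 upgraded from the mass to the law of
the curve). [difficulty: open-problem] -/
@[route_item "route-CriticalPhenomena-SAWTrackTransport"]
def ArchTransport : Prop :=
  open MeasureTheory Filter Literature.Probability.RandomPlanarGeometry Literature.Probability.RandomPlanarGeometry.SAW.YangBaxter in let archLaw : (ℤ → ℝ) → ℝ → ℤ → ℤ → Measure (CurveClass ℂ) := fun Θ δ m n => (let W : Measure (CurveClass ℂ) := Measure.sum fun γ : YBWalk halfPlane (boundaryPoint m) (boundaryPoint n) => ENNReal.ofReal (γ.weight Θ) • Measure.dirac (γ.curve Θ δ); (W Set.univ)⁻¹ • W); ∀ α ∈ Set.Icc (Real.pi / 3) (2 * Real.pi / 3), ∀ (A B : ℝ), A < B → ∀ f : BoundedContinuousFunction (CurveClass ℂ) ℝ, Tendsto (fun δ : ℝ => (∫ c, f c ∂(archLaw (fun (_ : ℤ) => Real.pi / 2) δ ⌊A / δ⌋ ⌊B / δ⌋)) - ∫ c, f c ∂(archLaw (fun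 (_ : ℤ) => α) δ ⌊A / δ⌋ ⌊B / δ⌋)) (𝓝[>] (0 : ℝ)) (𝓝 0)

/-- item stmt-CriticalPhenomena-8230 · support · rank 9 · open · by planner
sources: LawlerSchrammWerner2003Restriction
[support] (route-repair 2026-08-15; replaces the guarded shared item LSWRestrictionFact =
stmt-CriticalPhenomena-0775 in this route) Lawler–Schramm–Werner 2003, Conformal restriction: the
chordal case (arXiv:math/0209343), p. 5 result 2 with Prop. 3.3, Thm 6.1, Cor. 8.6, transposed to
chordal curve families on Dobrushin domains: a chordal family that is conformally covariant
(ChordalFamily.IsConformallyCovariant, inlined), has the two-sided restriction property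
(ChordalFamily.IsRestriction, inlined) and is carried by simple curves meeting ∂D only at the marked
points is, in every Dobrushin domain, the chordal SLE_{8/3} law (IsSLELaw (8/3)). VERBATIM the
Literature named fact `Literature.Probability.RandomPlanarGeometry.LawlerSchrammWerner2003`
(ConformalRestriction.lean), PROVED in the tree: `LawlerSchrammWerner2003_holds`
(ConformalRestrictionHolds.lean; axioms propext/Classical.choice/Quot.sound) — closes in one line
`LawlerSchrammWerner2003_holds` after `import
Literature.Probability.RandomPlanarGeometry.ConformalRestrictionHolds`. Unlike 0775 it carries no
`exists_isSLECurve →` guard (that all-κ fact is in-tree equivalent to the open SLE₈ trace theorem),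
so the Assembly can con -/
@[route_item "route-CriticalPhenomena-SAWTrackTransport"]
def LSW2003Characterisation : Prop :=
  ∀ P : Literature.Probability.RandomPlanarGeometry.ChordalFamily, P.IsChordal → (∀ (D D' : Literature.Probability.RandomPlanarGeometry.DobrushinDomain) (g : Literature.Probability.RandomPlanarGeometry.ConformalEquiv D.carrier D'.carrier) (Φ : C(ℂ, ℂ)), g.HasBoundaryValue (D.pt 0) (D'.pt 0) → g.HasBoundaryValue (D.pt 1) (D'.pt 1) → Set.EqOn Φ g D.carrier → P D' = (P D).map (Literature.Probability.RandomPlanarGeometry.CurveClass.map Φ)) → (∀ (D D' : Literature.Probability.RandomPlanarGeometry.DobrushinDomain), D'.carrier ⊆ D.carrier → D'.pt 0 = D.pt 0 → D'.pt 1 = D.pt 1 → ∀ T : Set (Literature.Probability.RandomPlanarGeometry.CurveClass ℂ), MeasurableSet T → P D' T * P D (Literature.Probability.RandomPlanarGeometry.CurveClass.rangeSubset (closure D'.carrier)) = P D (T ∩ Literature.Probability.RandomPlanarGeometry.CurveClass.rangeSubset (closure D'.carrier))) → (∀ D : Literature.Probability.RandomPlanarGeometry.DobrushinDomain, ∀ᵐ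 γ ∂(P D), γ ∈ Literature.Probability.RandomPlanarGeometry.CurveClass.simple ∧ γ.range ∩ frontier D.carrier ⊆ {D.pt 0, D.pt 1}) → ∀ D : Literature.Probability.RandomPlanarGeometry.DobrushinDomain, Literature.Probability.RandomPlanarGeometry.IsSLELaw ((8 : NNReal) / 3) D (P D)

-- earlier Assembly (stmt-CriticalPhenomena-16970, replaced 2026-08-16T21:52:14Z -> stmt-CriticalPhenomena-16996): retired by None — AngleUniversality → YBLimitExists → AxiomsOfLimit → RStarRot → YBtoUniform → RotationFromAngles → LSW2003Characterisation → YBApproxExists → _root_.SAWScalingLimit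
-- earlier Assembly (stmt-CriticalPhenomena-16996, replaced 2026-08-16T22:03:14Z -> stmt-CriticalPhenomena-17010): retired by None — AngleUniversality → YBLimitExists → AxiomsOfLimit → RStarRot → YBtoUniform → MirrorRotation → _root_.SAWScalingLimit
-- earlier Assembly (stmt-CriticalPhenomena-17010, replaced 2026-08-16T22:06:08Z -> stmt-CriticalPhenomena-17011): retired by None — AngleUniversality → YBLimitExists → AxiomsOfLimit → RStarRot → YBtoUniform → MirrorRotation → LSW2003Characterisation → _root_.SAWScalingLimit
/-- item stmt-CriticalPhenomena-17011 · assembly · rank 1 · open · by planner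
sources: DKKMO2020Rotational, LawlerSchrammWerner2003Restriction, LawlerSchrammWerner2004SAW
[assembly] AngleUniversality → YBLimitExists → AxiomsOfLimit → RStarRot → YBtoUniform →
MirrorRotation → SAWScalingLimit — literally the type of `closes`. -/
@[route_item "route-CriticalPhenomena-SAWTrackTransport"]
def Assembly : Prop :=
  AngleUniversality → YBLimitExists → AxiomsOfLimit → RStarRot → YBtoUniform → MirrorRotation → _root_.SAWScalingLimit

/-! D-0027 §2.1 — DECIDING THEOREM (planner-authored via `route open/edit --closes-file`; by planner-rrepair-CriticalPhenomena-SAWTrackTran-76075f27-0 2026-08-16T22:06:08Z):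
its hypotheses are this route's items and its conclusion the sub-problem Statement (glue_lint), and it elaborates with this file. -/

@[closes "route-CriticalPhenomena-SAWTrackTransport"] theorem closes (h₂ : AngleUniversality) (h₃ : YBLimitExists) (h₄ : AxiomsOfLimit) (h₅ : RStarRot)
    (h₆ : YBtoUniform) (h₇ : MirrorRotation) : _root_.SAWScalingLimit := by
  intro D a b hab
  -- `π/2` lies in Glazman–Manolescu's range `[π/3, 2π/3]`
  have hpi : Real.pi / 2 ∈ Set.Icc (Real.pi / 3) (2 * Real.pi / 3) := by
    constructor <;> nlinarith [Real.pi_pos]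
  -- endpoint approximations at every angle, and the robust full limit `P` of the square-tiling walk
  obtain ⟨happAll, P, hPch, hconv⟩ := h₃
  have h₉' : ∀ D : Literature.Probability.RandomPlanarGeometry.DobrushinDomain, ∃ a b : ℝ → Literature.Probability.RandomPlanarGeometry.SAW.YangBaxter.MidEdge,
      Literature.Probability.RandomPlanarGeometry.SAW.YangBaxter.IsYBEndpointApprox (fun (_ : ℤ) => Real.pi / 2) D a b :=
    fun D => happAll (Real.pi / 2) hpi D
  -- the axioms of the limit that need no rotation
  obtain ⟨-, hSimOfRot, hRM, hRev, hConj, hSimple⟩ := h₄ P hPch h₉' hconv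
  -- rotation covariance from angle universality (track transport) by the reflection trick
  have hrot := h₇ h₂ happAll P hPch hconv
  -- full Literature.Probability.RandomPlanarGeometry.similarity covariance
  have hSim : P.IsSimilarityCovariant := hSimOfRot hrot
  -- rotation-invariant restriction–Markov rigidity: conformal covariance
  have hCC : P.IsConformallyCovariant := h₅ P hPch hRM hRev hSim hConj hSimple
  -- Lawler–Schramm–Werner 2003 (PROVED Literature theorem): each `P D` is the chordal SLE_{8/3} law
  obtain ⟨Γ, hΓ, hlaw⟩ :=
    Literature.Probability.RandomPlanarGeometry.LawlerSchrammWerner2003_holds P hPch hCC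
      hRM.isRestriction hSimple D
  -- a square-tiling endpoint approximation of `D`
  obtain ⟨a', b', happ⟩ := h₉' D
  -- the robust limit specialised to the unshifted domain (`u ≡ 0`)
  have hD : (D.map (Literature.Probability.RandomPlanarGeometry.similarity 1 one_ne_zero 0)).carrier = D.carrier := by
    ext z; simp [Literature.Probability.RandomPlanarGeometry.MarkedDomain.carrier_map]
  have hu : ∀ᶠ δ in 𝓝[>] (0 : ℝ), ‖(fun _ : ℝ => (0 : ℂ)) δ‖ ≤ δ := by
    filter_upwards [self_mem_nhdsWithin] with δ hδ
    simpa using le_of_lt hδ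
  have hconv0 := hconv D (fun _ : ℝ => (0 : ℂ)) a' b' hu
  -- transport along the (propositional) equality of carriers
  have key : ∀ T : Set ℂ, T = D.carrier →
      ((∀ᶠ δ in 𝓝[>] (0 : ℝ), Nonempty (Literature.Probability.RandomPlanarGeometry.SAW.YangBaxter.YangBaxterSAW (fun (_ : ℤ) => Real.pi / 2) T δ (a' δ) (b' δ))) →
        Tendsto (fun δ : ℝ => (δ : ℂ) * Literature.Probability.RandomPlanarGeometry.SAW.YangBaxter.planeMidpoint (fun (_ : ℤ) => Real.pi / 2) (a' δ))
          (𝓝[>] (0 : ℝ)) (𝓝 (D.pt 0)) →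
        Tendsto (fun δ : ℝ => (δ : ℂ) * Literature.Probability.RandomPlanarGeometry.SAW.YangBaxter.planeMidpoint (fun (_ : ℤ) => Real.pi / 2) (b' δ))
          (𝓝[>] (0 : ℝ)) (𝓝 (D.pt 1)) →
        Literature.Probability.RandomPlanarGeometry.TendstoLaw (fun δ (γ : Literature.Probability.RandomPlanarGeometry.SAW.YangBaxter.YangBaxterSAW (fun (_ : ℤ) => Real.pi / 2) T δ (a' δ) (b' δ)) =>
            γ.curve (fun (_ : ℤ) => Real.pi / 2) δ)
          (fun δ => Literature.Probability.RandomPlanarGeometry.SAW.YangBaxter.ybLaw (fun (_ : ℤ) => Real.pi / 2) T δ 1 (a' δ) (b' δ)) id (P D)) →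
      Literature.Probability.RandomPlanarGeometry.TendstoLaw (fun δ (γ : Literature.Probability.RandomPlanarGeometry.SAW.YangBaxter.YangBaxterSAW (fun (_ : ℤ) => Real.pi / 2) D.carrier δ (a' δ) (b' δ)) =>
          γ.curve (fun (_ : ℤ) => Real.pi / 2) δ)
        (fun δ => Literature.Probability.RandomPlanarGeometry.SAW.YangBaxter.ybLaw (fun (_ : ℤ) => Real.pi / 2) D.carrier δ 1 (a' δ) (b' δ)) id (P D) := by
    intro T hT h
    subst hT
    exact h happ.nonempty happ.tendsto_fst happ.tendsto_snd
  have hfix := key _ hD hconv0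
  refine ⟨Γ, hΓ, Filter.Eventually.of_forall fun δ =>
    Literature.Probability.RandomPlanarGeometry.SAW.aemeasurable_curve _ _ _ _, fun f => ?_⟩
  have hlim : ∫ ω, f (Γ ω) ∂Literature.Probability.Process.preWienerMeasure = ∫ x, f x ∂(P D) := by
    rw [hlaw, MeasureTheory.integral_map hΓ.aemeasurable f.continuous.aestronglyMeasurable]
  rw [hlim]
  have hsum := (h₆ D a b a' b' hab happ f).add (hfix f)
  rw [zero_add] at hsum
  exact hsum.congr fun δ => sub_add_cancel _ _

end Summit.CriticalPhenomena.SAWScalingLimit.Theses.SAWTrackTransport
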